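import Literature.Topology.FourManifolds.BandSumSymmetry
import Literature.Topology.FourManifolds.ParameterMatching
import HarnessLib

/-!
# Band sums with the same regular band: matching the two lower arcs over one parameter window

Fact seat `provefact-Literature.Topology.FourManifolds.BandData.exists_ambientIsotopy_of_band_eq_of_isRegular`
(`BandSumIsotopyRegular.lean`). Let `b`, `b'` be band-sum data for `K`, `K'` with the same band and
collar, thickened (`T : PatchThickening b.band δ₀ δ₁`, `b.δ < δ₁`), the summands `K₁`, `K₂`
disjoint, and let `φ`, `φ'` be lifts of the two closed lower arcs through `K ∘ circlePt`,
`K' ∘ circlePt` (`BandData.IsLowerLift`; windows `[φ 0, φ 1]`, `[φ' 0, φ' 1]`). This file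
re-parametrises the window of `K'` over the window of `K` (`BandData.exists_windowMatching`): there
is `σ`, `C^∞` with positive derivative on a neighbourhood of `[φ 0, φ 1]`, `σ (φ 0) = φ' 0`,
`σ (φ 1) = φ' 1`, such that

* near both ends of the window the planar `x₁`-coordinates (in the thickening) of
  `K' (circlePt (σ t))` and `K (circlePt t)` **agree**, and
* just outside the window, `K' (circlePt (σ t)) = K (circlePt t)` — there both knots run on the
  same summand (`K₁` before the window, `K₂` after it), off the band surface, and that summand is a
  graph over `x₁` near the attaching point.

Everything here is proved; no named facts are introduced. Ingredients: the junction analysis of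
`BandSumJunction.lean`, `BandSumJunctionCoords.lean` at the incoming attaching point
`p = band (0, -δ)` (`deriv_planar_track_one_pos`, `deriv_planar_left_track_one_pos`,
`eventually_exists_apply_eq_left`), transported to the outgoing attaching point `p' = band (1, -δ)`
by the reverse–mirror symmetry of `BandSumSymmetry.lean` (`BandData.reverseMirror`,
`PatchThickening.mirror`), and the one-variable matching/gluing lemmas of `ParameterMatching.lean`.

## References

* P. R. Cromwell, *Knots and Links* (2004), §4.6 (the product of oriented knots along a rectangle
  `R`: the factors enter and leave `R` through its corners). [Cromwell2004]
* M. W. Hirsch, *Differential Topology* (1976), Ch. 8 §1. [HirschDT1976]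

## Design notes

* `IsLowerLift` packages the three properties of the lifts produced by `exists_lift_lowerCurve`;
  thickenings of `b'.band = b.band` are obtained by transport (`PatchThickening.exists_cast`), so
  the interface only mentions `T`.
* Local notation `𝔼 n`, `𝕊 n` follows the directory pattern. Nothing here uses `sorry`.
-/

open scoped Manifold ContDiff Topology Real
open Function Set Metric Filter

noncomputable section

namespace Literature.Topology.FourManifolds

/-- Local notation: `𝔼 n` is the model Euclidean space `EuclideanSpace ℝ (Fin n)`. -/
local notation "𝔼 " n:arg => EuclideanSpace ℝ (Fin n)

/-- Local notation: `𝕊 n` is the unit sphere in `EuclideanSpace ℝ (Fin (n + 1))`. -/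
local notation "𝕊 " n:arg => (Metric.sphere (0 : EuclideanSpace ℝ (Fin (n + 1))) 1)

/-! ## Transporting a thickening along an equality of patches -/

namespace PatchThickening

/-- A thickening of a patch is a thickening of any patch equal to it, with the same thickening
map, parametrisation, chart, planar and height coordinates. [folklore] -/
theorem exists_cast {β β' : 𝔼 2 → 𝕊 3} {δ₀ δ₁ : ℝ} (h : β' = β) (T : PatchThickening β δ₀ δ₁) :
    ∃ T' : PatchThickening β' δ₀ δ₁, T'.emb = T.emb ∧ T'.param = T.param ∧ T'.chart = T.chart ∧
      (∀ c, T'.planar c = T.planar c) ∧ ∀ c, T'.height c = T.height c := by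
  subst h
  exact ⟨T, rfl, rfl, rfl, fun _ ↦ rfl, fun _ ↦ rfl⟩

/-- The mirrored thickening has the same `x₁`-coordinate. [folklore] -/
theorem planar_mirror_apply_one {β : 𝔼 2 → 𝕊 3} {δ₀ δ₁ : ℝ} (T : PatchThickening β δ₀ δ₁) (c : 𝕊 3) :
    T.mirror.planar c 1 = T.planar c 1 := by
  rw [planar_mirror, mirrorX_apply_one]

end PatchThickening

/-! ## The reversed knot along the unit-period parametrisation -/

namespace Knot

/-- `K.reverse (circlePt t) = K (circlePt (-t))`. [folklore] -/
theorem reverse_apply_circlePt (K : Knot) (t : ℝ) : (K.reverse : Knot) (circlePt t) = K (circlePt (-t)) := by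
  rw [circlePt_eq_circlePoint, reverse_apply_circlePoint', circlePt_eq_circlePoint]
  congr 2; ring

end Knot

namespace BandData

variable {K₁ K₂ K K' : Knot} {avoid avoid' : Set (𝕊 3)} (b : BandData K₁ K₂ K avoid)
  (b' : BandData K₁ K₂ K' avoid')
variable {δ₀ δ₁ : ℝ} (T : PatchThickening b.band δ₀ δ₁)

/-! ## Lifts of the closed lower arc -/

/-- **A lift of the closed lower arc through `K ∘ circlePt`**: continuous, strictly increasing on
`[0, 1]`, with `K (circlePt (φ s)) = band (lowerArc s)` on `[0, 1]` (the output of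
`exists_lift_lowerCurve`). Its *window* is `[φ 0, φ 1]`. [folklore] -/
def IsLowerLift (φ : ℝ → ℝ) : Prop :=
  Continuous φ ∧ StrictMonoOn φ (Icc 0 1) ∧ ∀ s ∈ Icc (0 : ℝ) 1, K (circlePt (φ s)) = b.lowerCurve s

/-- Lifts of the closed lower arc exist. [folklore] -/
theorem exists_isLowerLift : ∃ φ, b.IsLowerLift φ := b.exists_lift_lowerCurve

namespace IsLowerLift

variable {b} {φ : ℝ → ℝ} (hφ : b.IsLowerLift φ)
include hφ

/-- Continuity of a lift. [folklore] -/
theorem continuous : Continuous φ := hφ.1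

/-- Monotonicity of a lift. [folklore] -/
theorem strictMonoOn : StrictMonoOn φ (Icc 0 1) := hφ.2.1

/-- The lifting identity. [folklore] -/
theorem apply_eq {s : ℝ} (hs : s ∈ Icc (0 : ℝ) 1) : K (circlePt (φ s)) = b.lowerCurve s := hφ.2.2 s hs

/-- The window is nondegenerate. [folklore] -/
theorem zero_lt_one : φ 0 < φ 1 :=
  hφ.strictMonoOn (left_mem_Icc.2 zero_le_one) (right_mem_Icc.2 zero_le_one) _root_.zero_lt_one

/-- The window is shorter than the period. [folklore] -/
theorem one_lt (hcl : InjOn b.band (closedSquare b.δ)) : φ 1 < φ 0 + 1 :=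
  b.lift_lowerCurve_one_lt hcl hφ.continuous hφ.strictMonoOn hφ.2.2

/-- The start of the window maps to `p = band (0, -δ)`. [folklore] -/
theorem apply_zero : K (circlePt (φ 0)) = b.band (pt2 0 (-b.δ)) := by
  rw [hφ.apply_eq (left_mem_Icc.2 zero_le_one), lowerCurve_zero]

/-- The end of the window maps to `p' = band (1, -δ)`. [folklore] -/
theorem apply_one : K (circlePt (φ 1)) = b.band (pt2 1 (-b.δ)) := by
  rw [hφ.apply_eq (right_mem_Icc.2 zero_le_one), lowerCurve_one]

/-- A shifted lift is a lift. [folklore] -/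
theorem add_int (m : ℤ) : b.IsLowerLift fun s ↦ φ s + m :=
  ⟨hφ.continuous.add continuous_const, fun _ hs _ ht hst ↦ by simpa using hφ.strictMonoOn hs ht hst,
    fun s hs ↦ by rw [circlePt_add_int, hφ.apply_eq hs]⟩

/-- Every parameter of the window is a lifted parameter. [folklore] -/
theorem exists_eq_of_mem {t : ℝ} (ht : t ∈ Icc (φ 0) (φ 1)) : ∃ s ∈ Icc (0 : ℝ) 1, φ s = t :=
  intermediate_value_Icc zero_le_one hφ.continuous.continuousOn ht

/-- On the window the knot runs along the closed lower arc, in the coordinates of a thickening over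
a wider collar: in the image of the thickening, planar coordinate on the planar lower arc (in the
closed collar square, with `x₁ < 1/2`), height zero. [folklore] -/
theorem track_of_mem (hδ₁ : b.δ < δ₁) {t : ℝ} (ht : t ∈ Icc (φ 0) (φ 1)) :
    ∃ s ∈ Icc (0 : ℝ) 1, φ s = t ∧ K (circlePt t) = b.band (b.lowerArc s) ∧
      K (circlePt t) ∈ range T.emb ∧ T.planar (K (circlePt t)) = b.lowerArc s ∧
      T.height (K (circlePt t)) = 0 ∧ b.lowerArc s ∈ closedSquare b.δ := by
  obtain ⟨s, hs, rfl⟩ := hφ.exists_eq_of_mem ht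
  have hmem : b.lowerArc s ∈ range T.param :=
    b.closedSquare_subset_range_param T hδ₁ (b.lowerArc_mem_closedSquare hs)
  refine ⟨s, hs, rfl, hφ.apply_eq hs, ?_, ?_, ?_, b.lowerArc_mem_closedSquare hs⟩
  · rw [hφ.apply_eq hs]; exact T.apply_mem_range_emb hmem
  · rw [hφ.apply_eq hs]; exact T.planar_apply_patch hmem
  · rw [hφ.apply_eq hs]; exact T.height_apply_patch hmem

/-- On the open window the planar coordinate lies in the open lower half of the collar square.
[folklore] -/
theorem planar_mem_of_mem_Ioo (hδ₁ : b.δ < δ₁) {t : ℝ} (ht : t ∈ Ioo (φ 0) (φ 1)) :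
    T.planar (K (circlePt t)) ∈ squareNhd b.δ ∧ T.planar (K (circlePt t)) 1 < 2⁻¹ := by
  obtain ⟨s, hs, hst, -, -, hpl, -, -⟩ := hφ.track_of_mem T hδ₁ (Ioo_subset_Icc_self ht)
  have hs' : s ∈ Ioo (0 : ℝ) 1 := by
    refine ⟨lt_of_le_of_ne hs.1 ?_, lt_of_le_of_ne hs.2 ?_⟩
    · rintro rfl; exact ht.1.ne hst
    · rintro rfl; exact ht.2.ne' hst
  rw [hpl]
  exact b.lowerArc_mem s hs'

/-- On the closed window the planar `x₁`-coordinate is `< 1/2`. [folklore] -/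
theorem planar_apply_one_lt (hδ₁ : b.δ < δ₁) {t : ℝ} (ht : t ∈ Icc (φ 0) (φ 1)) :
    T.planar (K (circlePt t)) 1 < 2⁻¹ := by
  obtain ⟨s, hs, -, -, -, hpl, -, -⟩ := hφ.track_of_mem T hδ₁ ht
  rw [hpl]
  have hδ := b.δ_pos
  rcases hs.1.eq_or_lt with rfl | h0
  · rw [b.lowerArc_zero, pt2_apply_one]; linarith
  rcases hs.2.eq_or_lt with rfl | h1
  · rw [b.lowerArc_one, pt2_apply_one]; linarith
  exact (b.lowerArc_mem s ⟨h0, h1⟩).2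

/-- The track lies in the image of the thickening on a neighbourhood of the closed window.
[folklore] -/
theorem exists_track_mem (hδ₁ : b.δ < δ₁) :
    ∃ κ > 0, ∀ t ∈ Ioo (φ 0 - κ) (φ 1 + κ), K (circlePt t) ∈ range T.emb := by
  obtain ⟨κ₀, hκ₀, h₀⟩ := T.exists_Ioo_subset_track_mem K (a := φ 0)
    (hφ.apply_zero ▸ b.band_lowerLeft_mem_range_emb T hδ₁)
  obtain ⟨-, -, -, -, h1mem, -⟩ := hφ.track_of_mem T hδ₁ (right_mem_Icc.2 hφ.zero_lt_one.le)
  obtain ⟨κ₁, hκ₁, h₁⟩ := T.exists_Ioo_subset_track_mem K (a := φ 1) h1mem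
  refine ⟨min κ₀ κ₁, lt_min hκ₀ hκ₁, fun t ht ↦ ?_⟩
  by_cases h0 : t < φ 0
  · exact h₀ t ⟨by linarith [ht.1, min_le_left κ₀ κ₁], by linarith⟩
  by_cases h1 : φ 1 < t
  · exact h₁ t ⟨by linarith, by linarith [ht.2, min_le_right κ₀ κ₁]⟩
  push Not at h0 h1
  obtain ⟨-, -, -, -, hmem, -⟩ := hφ.track_of_mem T hδ₁ ⟨h0, h1⟩
  exact hmem

/-- The planar track is injective on the closed window (the band is injective near the closed lower
arc and the window is shorter than the period). [folklore] -/
theorem injOn_planar_track (hδ₁ : b.δ < δ₁) : InjOn (fun t ↦ T.planar (K (circlePt t))) (Icc (φ 0) (φ 1)) := by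
  intro t ht t' ht' htt'
  obtain ⟨s, -, -, hK, -, hpl, -, -⟩ := hφ.track_of_mem T hδ₁ ht
  obtain ⟨s', -, -, hK', -, hpl', -, -⟩ := hφ.track_of_mem T hδ₁ ht'
  simp only at htt'
  rw [hpl, hpl'] at htt'
  have hKK : K (circlePt t) = K (circlePt t') := by rw [hK, hK', htt']
  have h1 := hφ.one_lt (b.injOn_band_closedSquare T hδ₁)
  obtain ⟨m, hm⟩ := K.apply_circlePt_eq_iff.1 hKK
  have hlt : (-1 : ℝ) < m := by linarith [ht.1, ht'.2]
  have hgt : (m : ℝ) < 1 := by linarith [ht.2, ht'.1]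
  have h1' : (-1 : ℤ) < m := by exact_mod_cast hlt
  have h2' : m < (1 : ℤ) := by exact_mod_cast hgt
  obtain rfl : m = 0 := by omega
  simpa using hm

/-! ### The reverse–mirror of a lift -/

/-- **The reversed lift**: `s ↦ -φ (1 - s)` lifts the closed lower arc of the reverse–mirror data
through `K.reverse ∘ circlePt`; its window is `[-φ 1, -φ 0]`. [folklore] -/
theorem reverseMirror : b.reverseMirror.IsLowerLift fun s ↦ -φ (1 - s) := by
  refine ⟨(hφ.continuous.comp (continuous_const.sub continuous_id)).neg, ?_, ?_⟩
  · intro s hs t ht hst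
    have := hφ.strictMonoOn ⟨by linarith [ht.2], by linarith [ht.1]⟩ ⟨by linarith [hs.2], by linarith [hs.1]⟩
      (by linarith : 1 - t < 1 - s)
    simpa using this
  · intro s hs
    rw [Knot.reverse_apply_circlePt, neg_neg, reverseMirror_lowerCurve]
    exact hφ.apply_eq ⟨by linarith [hs.2], by linarith [hs.1]⟩

end IsLowerLift

/-! ## Planar `x₁`-speed at the two ends of the window -/

/-- **`K` arrives at `p` with positive planar `x₁`-speed** (`deriv_planar_track_one_pos`, restated
for `IsLowerLift`). [folklore] -/
theorem deriv_planar_one_pos_left (hδ₁ : b.δ < δ₁) (hdisj : Disjoint (range K₁) (range K₂))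
    {φ : ℝ → ℝ} (hφ : b.IsLowerLift φ) :
    0 < deriv (fun t ↦ T.planar (K (circlePt t)) 1) (φ 0) :=
  b.deriv_planar_track_one_pos T hδ₁ hdisj hφ.continuous hφ.strictMonoOn hφ.2.2

/-- Disjointness of the reversed summands. [folklore] -/
theorem disjoint_range_reverse (hdisj : Disjoint (range K₁) (range K₂)) :
    Disjoint (range (K₂.reverse : Knot)) (range (K₁.reverse : Knot)) := by
  rw [Knot.range_reverse, Knot.range_reverse]; exact hdisj.symm

/-- **`K` leaves `p'` with negative planar `x₁`-speed**: the positive statement at `p` for the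
reverse–mirror data (for which `p'` is the incoming attaching point of `K.reverse`), read back
through `K.reverse (circlePt t) = K (circlePt (-t))` and the mirrored thickening (which has the
same `x₁`-coordinate). [folklore] -/
theorem deriv_planar_one_neg_right (hδ₁ : b.δ < δ₁) (hdisj : Disjoint (range K₁) (range K₂))
    {φ : ℝ → ℝ} (hφ : b.IsLowerLift φ) :
    deriv (fun t ↦ T.planar (K (circlePt t)) 1) (φ 1) < 0 := by
  have h := b.reverseMirror.deriv_planar_one_pos_left T.mirror hδ₁ (disjoint_range_reverse hdisj) hφ.reverseMirror
  have hfun : (fun t ↦ PatchThickening.planar (β := b.reverseMirror.band) T.mirror ((K.reverse : Knot) (circlePt t)) 1) =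
      fun t ↦ (fun s ↦ T.planar (K (circlePt s)) 1) (-t) := by
    funext t
    have h1 := T.planar_mirror_apply_one ((K.reverse : Knot) (circlePt t))
    rw [Knot.reverse_apply_circlePt] at h1 ⊢
    exact h1
  simp only [sub_zero] at h
  rw [hfun, deriv_comp_neg (fun s ↦ T.planar (K (circlePt s)) 1) (-φ 1), neg_neg] at h
  linarith

/-! ## Both knots run on the same summand just outside the window -/

/-- **Just before the window, `K` and `K'` run on `K₁`, which is a graph over `x₁` there**: for
parameters `t < φ 0`, `t' < φ' 0` close to the starts of the two windows, equality of the planar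
`x₁`-coordinates of `K (circlePt t)` and `K' (circlePt t')` forces equality of the points. Both
points are `K₁ (circlePt u)`, `K₁ (circlePt u')` with `u`, `u'` just left of the parameter `χ 0` of
`p` on `K₁` (`eventually_exists_apply_eq_left`, for `b` and for `b'`, with a common lift `χ` of the
common left edge), where the `x₁`-coordinate of `K₁` is strictly increasing
(`deriv_planar_left_track_one_pos`). [folklore] -/
theorem exists_apply_eq_of_planar_one_eq_left (hδ₁ : b.δ < δ₁) (hdisj : Disjoint (range K₁) (range K₂))
    (hband : b'.band = b.band) (hδ : b'.δ = b.δ) {φ φ' : ℝ → ℝ} (hφ : b.IsLowerLift φ)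
    (hφ' : b'.IsLowerLift φ') :
    ∃ κ > 0, ∀ t ∈ Ioo (φ 0 - κ) (φ 0), ∀ t' ∈ Ioo (φ' 0 - κ) (φ' 0),
      T.planar (K (circlePt t)) 1 = T.planar (K' (circlePt t')) 1 → K (circlePt t) = K' (circlePt t') := by
  obtain ⟨χ, hχ, hχm, hχe⟩ := b.exists_lift_leftEdge
  have hχe' : ∀ s ∈ Icc (0 : ℝ) 1, K₁ (circlePt (χ s)) = b'.leftEdge s := fun s hs ↦ by
    rw [hχe s hs, leftEdge_apply, leftEdge_apply, hband, hδ]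
  -- the `x₁`-track of `K₁` is strictly increasing near `χ 0`
  have hp₁ : K₁ (circlePt (χ 0)) = b.band (pt2 0 (-b.δ)) := by
    rw [hχe 0 (left_mem_Icc.2 zero_le_one), leftEdge_zero]
  have hmem₁ : K₁ (circlePt (χ 0)) ∈ range T.emb := hp₁ ▸ b.band_lowerLeft_mem_range_emb T hδ₁
  obtain ⟨κ₀, hκ₀, hκ₀mem⟩ := T.exists_Ioo_subset_track_mem K₁ hmem₁
  obtain ⟨κ₁, hκ₁, e, -, -, hmono, -, -⟩ := exists_openPartialHomeomorph_of_deriv_pos hκ₀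
    (fun t ht ↦ T.contDiffAt_planar_track_apply K₁ (hκ₀mem t ht) 1)
    (b.deriv_planar_left_track_one_pos T hδ₁ hχ hχm hχe)
  -- `K` and `K'` run on `K₁` just before `p`
  have hcl : InjOn b.band (closedSquare b.δ) := b.injOn_band_closedSquare T hδ₁
  have hcl' : InjOn b'.band (closedSquare b'.δ) := by rw [hband, hδ]; exact hcl
  have hev := b.eventually_exists_apply_eq_left hcl hdisj hφ.continuous hφ.strictMonoOn hφ.2.2 hχ hχm
    hχe hκ₁.1
  have hev' := b'.eventually_exists_apply_eq_left hcl' hdisj hφ'.continuous hφ'.strictMonoOn hφ'.2.2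
    hχ hχm hχe' hκ₁.1
  obtain ⟨l, hl, hsub⟩ := mem_nhdsLT_iff_exists_Ioo_subset.1 hev
  obtain ⟨l', hl', hsub'⟩ := mem_nhdsLT_iff_exists_Ioo_subset.1 hev'
  rw [mem_Iio] at hl hl'
  refine ⟨min (φ 0 - l) (φ' 0 - l'), lt_min (by linarith) (by linarith), fun t ht t' ht' hx ↦ ?_⟩
  obtain ⟨u, hu, hKu⟩ := hsub ⟨by linarith [ht.1, min_le_left (φ 0 - l) (φ' 0 - l')], ht.2⟩
  obtain ⟨u', hu', hKu'⟩ := hsub' ⟨by linarith [ht'.1, min_le_right (φ 0 - l) (φ' 0 - l')], ht'.2⟩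
  rw [hKu, hKu'] at hx ⊢
  have huI : u ∈ Ioo (χ 0 - κ₁) (χ 0 + κ₁) := ⟨hu.1, by linarith [hu.2, hκ₁.1]⟩
  have huI' : u' ∈ Ioo (χ 0 - κ₁) (χ 0 + κ₁) := ⟨hu'.1, by linarith [hu'.2, hκ₁.1]⟩
  rw [hmono.injOn huI huI' hx]

/-- **Just after the window, `K` and `K'` run on `K₂`, which is a graph over `x₁` there**: the
statement `exists_apply_eq_of_planar_one_eq_left` for the reverse–mirror data, read back through
`K.reverse (circlePt t) = K (circlePt (-t))` and the mirrored thickening. [folklore] -/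
theorem exists_apply_eq_of_planar_one_eq_right (hδ₁ : b.δ < δ₁) (hdisj : Disjoint (range K₁) (range K₂))
    (hband : b'.band = b.band) (hδ : b'.δ = b.δ) {φ φ' : ℝ → ℝ} (hφ : b.IsLowerLift φ)
    (hφ' : b'.IsLowerLift φ') :
    ∃ κ > 0, ∀ t ∈ Ioo (φ 1) (φ 1 + κ), ∀ t' ∈ Ioo (φ' 1) (φ' 1 + κ),
      T.planar (K (circlePt t)) 1 = T.planar (K' (circlePt t')) 1 → K (circlePt t) = K' (circlePt t') := by
  have hband' : b'.reverseMirror.band = b.reverseMirror.band := by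
    funext x
    show b'.band (mirrorX x) = b.band (mirrorX x)
    rw [hband]
  have hδ' : b'.reverseMirror.δ = b.reverseMirror.δ := hδ
  obtain ⟨κ, hκ, h⟩ := b.reverseMirror.exists_apply_eq_of_planar_one_eq_left b'.reverseMirror T.mirror hδ₁
    (disjoint_range_reverse hdisj) hband' hδ' hφ.reverseMirror hφ'.reverseMirror
  simp only [sub_zero] at h
  refine ⟨κ, hκ, fun t ht t' ht' hx ↦ ?_⟩
  have key := h (-t) ⟨by linarith [ht.2], by linarith [ht.1]⟩ (-t') ⟨by linarith [ht'.2], by linarith [ht'.1]⟩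
  have e1 : PatchThickening.planar (β := b.reverseMirror.band) T.mirror ((K.reverse : Knot) (circlePt (-t))) 1 =
      T.planar (K (circlePt t)) 1 := by
    have h1 := T.planar_mirror_apply_one ((K.reverse : Knot) (circlePt (-t)))
    rw [Knot.reverse_apply_circlePt, neg_neg] at h1 ⊢
    exact h1
  have e2 : PatchThickening.planar (β := b.reverseMirror.band) T.mirror ((K'.reverse : Knot) (circlePt (-t'))) 1 =
      T.planar (K' (circlePt t')) 1 := by
    have h1 := T.planar_mirror_apply_one ((K'.reverse : Knot) (circlePt (-t')))
    rw [Knot.reverse_apply_circlePt, neg_neg] at h1 ⊢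
    exact h1
  have key' := key (e1.trans (hx.trans e2.symm))
  rwa [Knot.reverse_apply_circlePt, Knot.reverse_apply_circlePt, neg_neg, neg_neg] at key'

/-! ## The window matching -/

/-- The planar `x₁`-coordinate of `p = band (0, -δ)`. [folklore] -/
theorem planar_band_lowerLeft_apply_one (hδ₁ : b.δ < δ₁) : T.planar (b.band (pt2 0 (-b.δ))) 1 = -b.δ := by
  rw [b.planar_band_lowerLeft T hδ₁, pt2_apply_one]

/-- The planar `x₁`-coordinate of `p' = band (1, -δ)`. [folklore] -/
theorem planar_band_lowerRight_apply_one (hδ₁ : b.δ < δ₁) : T.planar (b.band (pt2 1 (-b.δ))) 1 = -b.δ := by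
  rw [T.planar_apply_patch (b.closedSquare_subset_range_param T hδ₁
    (b.corner_mem_closedSquare (Or.inr rfl) (Or.inl rfl))), pt2_apply_one]

/-- **The window matching.** Let `b`, `b'` be band-sum data with the same band and collar,
thickened over a wider collar, with disjoint summands, and let `φ`, `φ'` be lifts of the two closed
lower arcs. There are `η > 0` and `σ : ℝ → ℝ` such that, on the strip `(φ 0 - η, φ 1 + η)`:
`σ` is `C^∞` with positive derivative and strictly increasing, `σ (φ 0) = φ' 0`, `σ (φ 1) = φ' 1`,
`σ` maps the window onto the window; both tracks `K (circlePt t)` and `K' (circlePt (σ t))` lie in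
the image of the thickening; near the two ends of the window their planar `x₁`-coordinates agree;
and off the open window the two points coincide. Construction: matching germs `τA` at `φ 0`
(increasing `x₁`, `exists_matchingGerm`) and `τB` at `φ 1` (decreasing `x₁`,
`exists_matchingGerm_of_neg`), glued by `exists_matchingGlue`; the point equalities by
`exists_apply_eq_of_planar_one_eq_left/right`. [folklore] -/
theorem exists_windowMatching (hδ₁ : b.δ < δ₁) (hdisj : Disjoint (range K₁) (range K₂))
    (hband : b'.band = b.band) (hδ : b'.δ = b.δ) {φ φ' : ℝ → ℝ} (hφ : b.IsLowerLift φ)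
    (hφ' : b'.IsLowerLift φ') :
    ∃ η > 0, ∃ σ : ℝ → ℝ,
      (∀ t ∈ Ioo (φ 0 - η) (φ 1 + η), ContDiffAt ℝ ∞ σ t ∧ 0 < deriv σ t) ∧
      StrictMonoOn σ (Ioo (φ 0 - η) (φ 1 + η)) ∧ σ (φ 0) = φ' 0 ∧ σ (φ 1) = φ' 1 ∧
      MapsTo σ (Icc (φ 0) (φ 1)) (Icc (φ' 0) (φ' 1)) ∧ SurjOn σ (Icc (φ 0) (φ 1)) (Icc (φ' 0) (φ' 1)) ∧
      (∀ t ∈ Ioo (φ 0 - η) (φ 1 + η), K (circlePt t) ∈ range T.emb ∧ K' (circlePt (σ t)) ∈ range T.emb) ∧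
      (∀ t ∈ Ioo (φ 0 - η) (φ 0 + η) ∪ Ioo (φ 1 - η) (φ 1 + η),
        T.planar (K' (circlePt (σ t))) 1 = T.planar (K (circlePt t)) 1) ∧
      (∀ t ∈ Ioo (φ 0 - η) (φ 1 + η), t ∉ Ioo (φ 0) (φ 1) → K' (circlePt (σ t)) = K (circlePt t)) := by
  have hδpos := b.δ_pos
  have hδ₁' : b'.δ < δ₁ := hδ ▸ hδ₁
  obtain ⟨T', hT'e, -, -, hT'p, -⟩ := PatchThickening.exists_cast hband T
  -- the two `x₁`-tracks
  set g : ℝ → ℝ := fun t ↦ T.planar (K (circlePt t)) 1 with hg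
  set g' : ℝ → ℝ := fun t ↦ T.planar (K' (circlePt t)) 1 with hg'
  have hg'T : (fun t ↦ T'.planar (K' (circlePt t)) 1) = g' := by funext t; rw [hT'p]
  -- tracks in the image of the thickening
  obtain ⟨κK, hκK, hKmem⟩ := hφ.exists_track_mem T hδ₁
  obtain ⟨κK', hκK', hK'mem⟩ := hφ'.exists_track_mem T' hδ₁'
  rw [hT'e] at hK'mem
  -- smoothness of the tracks
  have hgc : ∀ t ∈ Ioo (φ 0 - κK) (φ 1 + κK), ContDiffAt ℝ ∞ g t := fun t ht ↦
    T.contDiffAt_planar_track_apply K (hKmem t ht) 1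
  have hgc' : ∀ t ∈ Ioo (φ' 0 - κK') (φ' 1 + κK'), ContDiffAt ℝ ∞ g' t := fun t ht ↦ by
    rw [← hg'T]; exact T'.contDiffAt_planar_track_apply K' (hT'e ▸ hK'mem t ht) 1
  -- derivative signs at the four window ends
  have hA : 0 < deriv g (φ 0) := b.deriv_planar_one_pos_left T hδ₁ hdisj hφ
  have hA' : 0 < deriv g' (φ' 0) := by rw [← hg'T]; exact b'.deriv_planar_one_pos_left T' hδ₁' hdisj hφ'
  have hB : deriv g (φ 1) < 0 := b.deriv_planar_one_neg_right T hδ₁ hdisj hφ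
  have hB' : deriv g' (φ' 1) < 0 := by rw [← hg'T]; exact b'.deriv_planar_one_neg_right T' hδ₁' hdisj hφ'
  -- values at the ends
  have hg0 : g (φ 0) = -b.δ := by simp only [hg]; rw [hφ.apply_zero, b.planar_band_lowerLeft_apply_one T hδ₁]
  have hg1 : g (φ 1) = -b.δ := by simp only [hg]; rw [hφ.apply_one, b.planar_band_lowerRight_apply_one T hδ₁]
  have hg0' : g' (φ' 0) = -b.δ := by
    rw [← hg'T]; simp only; rw [hφ'.apply_zero, b'.planar_band_lowerLeft_apply_one T' hδ₁', hδ]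
  have hg1' : g' (φ' 1) = -b.δ := by
    rw [← hg'T]; simp only; rw [hφ'.apply_one, b'.planar_band_lowerRight_apply_one T' hδ₁', hδ]
  -- the point equalities off the window
  obtain ⟨κ₂, hκ₂, hleft⟩ := b.exists_apply_eq_of_planar_one_eq_left b' T hδ₁ hdisj hband hδ hφ hφ'
  obtain ⟨κ₃, hκ₃, hright⟩ := b.exists_apply_eq_of_planar_one_eq_right b' T hδ₁ hdisj hband hδ hφ hφ'
  -- the windows
  have h01 := hφ.zero_lt_one
  have h01' := hφ'.zero_lt_one
  -- matching germs
  have hκA0 : 0 < min κK κ₂ := lt_min hκK hκ₂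
  have hκA0' : 0 < min κK' κ₂ := lt_min hκK' hκ₂
  obtain ⟨κA, hκA, τA, hτA0, hτAm, hτA⟩ := exists_matchingGerm (g := g) (g' := g') (a := φ 0) (a' := φ' 0)
    hκA0 hκA0'
    (fun t ht ↦ hgc t ⟨by linarith [ht.1, min_le_left κK κ₂], by linarith [ht.2, min_le_left κK κ₂]⟩)
    (fun t ht ↦ hgc' t ⟨by linarith [ht.1, min_le_left κK' κ₂], by linarith [ht.2, min_le_left κK' κ₂]⟩)
    hA hA' (by rw [hg0, hg0'])
  have hκB0 : 0 < min κK κ₃ := lt_min hκK hκ₃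
  have hκB0' : 0 < min κK' κ₃ := lt_min hκK' hκ₃
  obtain ⟨κB, hκB, τB, hτB0, hτBm, hτB⟩ := exists_matchingGerm_of_neg (g := g) (g' := g') (a := φ 1)
    (a' := φ' 1) hκB0 hκB0'
    (fun t ht ↦ hgc t ⟨by linarith [ht.1, min_le_left κK κ₃], by linarith [ht.2, min_le_left κK κ₃]⟩)
    (fun t ht ↦ hgc' t ⟨by linarith [ht.1, min_le_left κK' κ₃], by linarith [ht.2, min_le_left κK' κ₃]⟩)
    hB hB' (by rw [hg1, hg1'])
  -- glue
  have hκAB : 0 < min κA κB := lt_min hκA.1 hκB.1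
  obtain ⟨η, hη, σ, hσ, hσm, hσA, hσB⟩ := exists_matchingGlue (τA := τA) (τB := τB) hκAB h01
    (by rw [hτA0, hτB0]; exact h01')
    (fun t ht ↦ (hτA t ⟨by linarith [ht.1, min_le_left κA κB], by linarith [ht.2, min_le_left κA κB]⟩).imp
      id And.left)
    (fun t ht ↦ (hτB t ⟨by linarith [ht.1, min_le_right κA κB], by linarith [ht.2, min_le_right κA κB]⟩).imp
      id And.left)
  have hη0 : 0 < η := hη.1
  have hκApos : 0 < κA := hκA.1
  have hκBpos : 0 < κB := hκB.1
  have hηA : η ≤ κA := hη.2.trans (min_le_left _ _)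
  have hηB : η ≤ κB := hη.2.trans (min_le_right _ _)
  have hκAK : κA ≤ κK := hκA.2.trans (min_le_left _ _)
  have hκA2 : κA ≤ κ₂ := hκA.2.trans (min_le_right _ _)
  have hκBK : κB ≤ κK := hκB.2.trans (min_le_left _ _)
  have hκB3 : κB ≤ κ₃ := hκB.2.trans (min_le_right _ _)
  have hσ0 : σ (φ 0) = φ' 0 := by rw [hσA _ (by linarith), hτA0]
  have hσ1 : σ (φ 1) = φ' 1 := by rw [hσB _ (by linarith), hτB0]
  -- `σ` maps the window onto the window
  have hmaps : MapsTo σ (Icc (φ 0) (φ 1)) (Icc (φ' 0) (φ' 1)) := by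
    intro t ht
    have hm := hσm.monotoneOn
    refine ⟨?_, ?_⟩
    · rw [← hσ0]
      exact hm ⟨by linarith, by linarith⟩ ⟨by linarith [ht.1], by linarith [ht.2]⟩ ht.1
    · rw [← hσ1]
      exact hm ⟨by linarith [ht.1], by linarith [ht.2]⟩ ⟨by linarith, by linarith⟩ ht.2
  have hsurj : SurjOn σ (Icc (φ 0) (φ 1)) (Icc (φ' 0) (φ' 1)) := by
    have hc : ContinuousOn σ (Icc (φ 0) (φ 1)) := fun t ht ↦
      (hσ t ⟨by linarith [ht.1], by linarith [ht.2]⟩).1.continuousAt.continuousWithinAt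
    have := intermediate_value_Icc h01.le hc
    rwa [hσ0, hσ1] at this
  -- point equalities off the open window
  have hoff : ∀ t ∈ Ioo (φ 0 - η) (φ 1 + η), t ∉ Ioo (φ 0) (φ 1) → K' (circlePt (σ t)) = K (circlePt t) := by
    intro t ht hnot
    rw [mem_Ioo, not_and_or, not_lt, not_lt] at hnot
    rcases hnot with hle | hge
    · -- left of the window
      rw [hσA t (by linarith)]
      rcases hle.eq_or_lt with rfl | hlt
      · rw [hτA0, hφ.apply_zero, hφ'.apply_zero, hband, hδ]
      · have htI : t ∈ Ioo (φ 0 - κA) (φ 0 + κA) := ⟨by linarith [ht.1], by linarith⟩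
        obtain ⟨-, -, hgg, hτI⟩ := hτA t htI
        have hτlt : τA t < φ' 0 := by rw [← hτA0]; exact hτAm htI ⟨by linarith, by linarith [hκA.1]⟩ hlt
        symm
        exact hleft t ⟨by linarith [ht.1], hlt⟩ (τA t) ⟨by linarith [hτI.1, min_le_right κK' κ₂], hτlt⟩ hgg.symm
    · -- right of the window
      rw [hσB t (by linarith)]
      rcases (show φ 1 = t ∨ φ 1 < t from hge.eq_or_lt) with rfl | hlt
      · rw [hτB0, hφ.apply_one, hφ'.apply_one, hband, hδ]
      · have htI : t ∈ Ioo (φ 1 - κB) (φ 1 + κB) := ⟨by linarith, by linarith [ht.2]⟩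
        obtain ⟨-, -, hgg, hτI⟩ := hτB t htI
        have hτgt : φ' 1 < τB t := by rw [← hτB0]; exact hτBm ⟨by linarith [hκB.1], by linarith⟩ htI hlt
        symm
        exact hright t ⟨hlt, by linarith [ht.2]⟩ (τB t) ⟨hτgt, by linarith [hτI.2, min_le_right κK' κ₃]⟩ hgg.symm
  refine ⟨η, hη.1, σ, hσ, hσm, hσ0, hσ1, hmaps, hsurj, ?_, ?_, hoff⟩
  · -- tracks in the image of the thickening
    intro t ht
    have hK : K (circlePt t) ∈ range T.emb := hKmem t ⟨by linarith [ht.1], by linarith [ht.2]⟩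
    refine ⟨hK, ?_⟩
    by_cases hin : t ∈ Ioo (φ 0) (φ 1)
    · obtain ⟨-, -, -, -, hmem, -⟩ := hφ'.track_of_mem T' hδ₁' (hmaps (Ioo_subset_Icc_self hin))
      rwa [hT'e] at hmem
    · rw [hoff t ht hin]; exact hK
  · -- `x₁`-matching near the ends
    rintro t (ht | ht)
    · rw [hσA t (by linarith [ht.2])]
      exact (hτA t ⟨by linarith [ht.1], by linarith [ht.2]⟩).2.2.1
    · rw [hσB t (by linarith [ht.1])]
      exact (hτB t ⟨by linarith [ht.1], by linarith [ht.2]⟩).2.2.1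

end BandData

end Literature.Topology.FourManifolds
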